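import Literature.Analysis.FluidPDE.PeriodicGalileanNonuniqueness
import Literature.Analysis.FluidPDE.IsometryInvariance
import HarnessLib

/-!
# The forcing symmetry: gradient forces are absorbed by the pressure (Tao 2013, §3 eq. (forcing))

Literature file (topic `Analysis/FluidPDE`; all statements are theorems), fourth of the
`PeriodicGalilean*` group on the symmetries of the Clay solution classes. Source: T. Tao,
*Localisation and compactness properties of the Navier–Stokes global regularity problem*, Anal.
PDE 6 (2013) = arXiv:1108.1165 [Tao2013Localisation], §3:

> "Finally, we observe that one can absorb divergences into the forcing term via the forcing
> symmetry `ũ(t,x) := u(t,x)`, `p̃(t,x) := p(t,x) + q(t,x)`, `ũ₀(x) := u₀(x)`,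
> `f̃(t,x) := f(t,x) + ∇·q(t,x)` … valid for any smooth function … In the periodic setting, we
> will apply (forcing) with a linear term `q(t,x) := x · a(t)`, allowing one to alter `f` by an
> arbitrary constant `a(t)`."

(For a scalar potential `q` the added force is `∇q`.) Formalised:
* `IsClassicalNSSolutionOn.add_gradient_force` — if `(u, p)` is a classical solution with force `f`
  on a time set `S` and `q` is jointly smooth on `S × E`, then `(u, p + q)` is a classical solution
  with force `f + ∇q` (same velocity, same datum);
* `IsClassicalNSSolutionOn.add_const_force` / `sub_const_force` — the linear potential
  `q(t,x) = ⟪a(t), x⟫`, `∇q = a(t)`: a spatially constant smooth force `a(t)` can be added to or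
  removed from any classical solution at the price of the non-periodic pressure term `⟪a(t), x⟫`;
* `IsNavierStokesSolution.add_const_force` — the same on Fefferman's class on `E × [0,∞)`;
* **`periodicSolvable_const_force`** — consequence for the printed periodic Clay class
  (condition (10) on `u` only): if the UNFORCED problem `(ν, u₀)` has a solution smooth on
  `ℝ^ι × [0,∞)` with `u(·,t)` periodic, then so does the problem forced by ANY smooth spatially
  constant `a(t)` — with the same velocity. Hence a pair `(u₀, f = a(t))` (such `f` is of Clay
  class (8)–(9) as soon as `a` decays in time) never witnesses printed (D) unless (B) already fails
  at `u₀` (`not_periodicBreakdownWitness_const_force`). In the CMI-errata class the absorbed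
  pressure `p + ⟪a(t), x⟫` is not periodic when `a(t) ≠ 0` (`isLatticePeriodic_add_inner_sub_iff`).

This is the elementary ("gradient part") half of the force-immunity of the printed periodic
problem; the full statement — Tao's Prop. 1.7, forced periodic regularity ⇔ unforced — needs
the `H¹` stability theory of §5–§6 and is not formalised.
-/

noncomputable section

open Set Function InnerProductSpace
open scoped ContDiff RealInnerProductSpace Topology Laplacian

namespace Literature.Analysis.FluidPDE

section Classical

variable {E : Type*} [NormedAddCommGroup E] [InnerProductSpace ℝ E] [FiniteDimensional ℝ E]
variable {S : Set ℝ} {ν : ℝ} {f u : ℝ → E → E} {p : ℝ → E → ℝ}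

/-- The gradient of the linear potential `x ↦ ⟪b, x⟫` is `b`. [folklore] -/
private theorem gradient_inner_const (b x : E) : gradient (fun z : E => ⟪b, z⟫) x = b := by
  have h1 : HasFDerivAt (fun z : E => ⟪b, z⟫) (toDual ℝ E b) x := by
    have : (fun z : E => ⟪b, z⟫) = toDual ℝ E b := by
      funext z
      rfl
    rw [this]
    exact (toDual ℝ E b).hasFDerivAt
  unfold gradient
  rw [h1.fderiv, LinearIsometryEquiv.symm_apply_apply]

/-- **The forcing symmetry (Tao 2013, §3 eq. (forcing)).** If `(u, p)` is a classical
Navier–Stokes solution with viscosity `ν` and force `f` on the time set `S`, and `q : ℝ → E → ℝ`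
is jointly smooth on `S × E`, then `(u, p + q)` is a classical solution with force `f + ∇q`: a
gradient force is absorbed by (or extracted from) the pressure, the velocity and the datum being
unchanged. [cite: Tao2013Localisation, §3 eq. (forcing)] -/
theorem IsClassicalNSSolutionOn.add_gradient_force (h : IsClassicalNSSolutionOn S ν f u p)
    {q : ℝ → E → ℝ} (hq : IsSmoothSpaceTimeOn S q) :
    IsClassicalNSSolutionOn S ν (fun t x => f t x + gradient (q t) x) u (fun t x => p t x + q t x) where
  smooth_velocity := h.smooth_velocity
  smooth_pressure := h.smooth_pressure.add hq
  momentum t ht x := by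
    have hp : DifferentiableAt ℝ (p t) x :=
      ((h.contDiff_pressure ht).differentiable (by simp)) x
    have hqd : DifferentiableAt ℝ (q t) x := ((hq.contDiff_slice ht).differentiable (by simp)) x
    have hg : gradient ((fun s y => p s y + q s y) t) x = gradient (p t) x + gradient (q t) x := by
      show gradient (fun y => p t y + q t y) x = _
      unfold gradient
      rw [fderiv_fun_add hp hqd, map_add]
    rw [hg, h.momentum t ht x]
    abel
  divFree := h.divFree

omit [FiniteDimensional ℝ E] in
/-- The linear potential `(t, x) ↦ ⟪a(t), x⟫` of a smooth `a` is jointly smooth. [folklore] -/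
private theorem isSmoothSpaceTimeOn_inner {a : ℝ → E} (ha : ContDiff ℝ ∞ a) :
    IsSmoothSpaceTimeOn S (fun t (x : E) => ⟪a t, x⟫) :=
  isSmoothSpaceTimeOn_of_contDiff ((ha.comp contDiff_fst).inner ℝ contDiff_snd)

/-- **A spatially constant force is absorbed by a linear pressure** ("we will apply (forcing)
with a linear term `q(t,x) := x · a(t)`, allowing one to alter `f` by an arbitrary constant
`a(t)`"): if `(u, p)` solves with force `f` then `(u, p + ⟪a(t), x⟫)` solves with force
`f + a(t)`, for every smooth `a : ℝ → E`. [cite: Tao2013Localisation, §3 eq. (forcing)] -/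
theorem IsClassicalNSSolutionOn.add_const_force (h : IsClassicalNSSolutionOn S ν f u p)
    {a : ℝ → E} (ha : ContDiff ℝ ∞ a) :
    IsClassicalNSSolutionOn S ν (fun t x => f t x + a t) u (fun t x => p t x + ⟪a t, x⟫) := by
  have h1 := h.add_gradient_force (isSmoothSpaceTimeOn_inner ha)
  refine h1.congr_force fun t _ x => ?_
  show f t x + gradient (fun z : E => ⟪a t, z⟫) x = f t x + a t
  rw [gradient_inner_const]

/-- Conversely a spatially constant force is REMOVED by subtracting the linear pressure: if
`(u, p)` solves with force `f + a(t)` then `(u, p − ⟪a(t), x⟫)` solves with force `f`.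
[cite: Tao2013Localisation, §3 eq. (forcing)] -/
theorem IsClassicalNSSolutionOn.sub_const_force {a : ℝ → E} (ha : ContDiff ℝ ∞ a)
    (h : IsClassicalNSSolutionOn S ν (fun t x => f t x + a t) u p) :
    IsClassicalNSSolutionOn S ν f u (fun t x => p t x - ⟪a t, x⟫) := by
  have h1 := h.add_const_force (a := fun t => -a t) ha.neg
  have e : (fun t x => p t x + ⟪(fun s => -a s) t, x⟫) = fun t x => p t x - ⟪a t, x⟫ := by
    funext t x
    simp [inner_neg_left, sub_eq_add_neg]
  rw [e] at h1
  exact h1.congr_force fun t _ x => by simp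

/-- **The forcing symmetry on Fefferman's class on `E × [0,∞)`**: a solution of (1)–(3) smooth
on the closed half-space with force `f` and datum `u₀` yields one with force `f + a(t)`, the
same velocity and datum, and pressure `p + ⟪a(t), x⟫` (smooth on the half-space).
[cite: Tao2013Localisation, §3 eq. (forcing)] -/
theorem IsNavierStokesSolution.add_const_force {u₀ : E → E} (hns : IsNavierStokesSolution ν f u₀ u p)
    (hu : IsSmoothOnHalfSpace u) (hp : IsSmoothOnHalfSpace p) {a : ℝ → E} (ha : ContDiff ℝ ∞ a) :
    IsNavierStokesSolution ν (fun t x => f t x + a t) u₀ u (fun t x => p t x + ⟪a t, x⟫) ∧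
      IsSmoothOnHalfSpace (fun t x => p t x + ⟪a t, x⟫) := by
  obtain ⟨hcl, h0⟩ := isNavierStokesSolution_and_smooth_iff.1 ⟨hns, hu, hp⟩
  obtain ⟨hns', -, hp'⟩ := isNavierStokesSolution_and_smooth_iff.2 ⟨hcl.add_const_force ha, h0⟩
  exact ⟨hns', hp'⟩

end Classical

/-! ### Consequence for the printed periodic Clay class -/

section Periodic

variable {ι : Type*} [Fintype ι] [DecidableEq ι]
variable {ν : ℝ} {u : ℝ → EuclideanSpace ℝ ι → EuclideanSpace ℝ ι}
  {u₀ : EuclideanSpace ℝ ι → EuclideanSpace ℝ ι} {p : ℝ → EuclideanSpace ℝ ι → ℝ}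

/-- **In the printed periodic class, spatially constant forcing never obstructs solvability.**
If the UNFORCED problem `(ν, u₀)` has a solution smooth on `ℝ^ι × [0,∞)` with `u(·,t)` periodic
for `t ≥ 0`, then for every smooth `a : ℝ → ℝ^ι` the problem with force `f(t, x) = a(t)` has one
too — the same velocity, pressure `p + ⟪a(t), x⟫` (periodic at time `t` only if `a(t) = 0`, given
`p(t)` periodic: `isLatticePeriodic_add_inner_sub_iff`). [cite: Tao2013Localisation, §3 eq. (forcing)] -/
theorem periodicSolvable_const_force (hns : IsNavierStokesSolution ν 0 u₀ u p)
    (hu : IsSmoothOnHalfSpace u) (hp : IsSmoothOnHalfSpace p)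
    (hper : ∀ t, 0 ≤ t → IsLatticePeriodic (u t)) {a : ℝ → EuclideanSpace ℝ ι}
    (ha : ContDiff ℝ ∞ a) :
    ∃ (v : ℝ → EuclideanSpace ℝ ι → EuclideanSpace ℝ ι) (q : ℝ → EuclideanSpace ℝ ι → ℝ),
      IsSmoothOnHalfSpace v ∧ IsSmoothOnHalfSpace q ∧
        IsNavierStokesSolution ν (fun t _ => a t) u₀ v q ∧ ∀ t, 0 ≤ t → IsLatticePeriodic (v t) := by
  obtain ⟨hns', hp'⟩ := hns.add_const_force hu hp ha
  refine ⟨u, fun t x => p t x + ⟪a t, x⟫, hu, hp', ?_, hper⟩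
  have e : (fun t (x : EuclideanSpace ℝ ι) => (0 : ℝ → EuclideanSpace ℝ ι → EuclideanSpace ℝ ι) t x + a t) =
      fun t _ => a t := by
    funext t x
    simp
  rw [e] at hns'
  exact hns'

/-- **No printed-(D) witness with a spatially constant force at a (B)-solvable datum**: if
`(ν, u₀)` has a global smooth `u`-periodic solution of the unforced system, then for every smooth
`a : ℝ → ℝ^ι` it is FALSE that «no `(u, p)` smooth on `ℝ^ι × [0,∞)` with `u(·,t)` periodic solves
(1)–(3) with force `a(t)` and datum `u₀`» — the `¬∃` matrix of Fefferman's (D), as printed, at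
the data `(u₀, a)`. [cite: Tao2013Localisation, §3 eq. (forcing)] -/
theorem not_periodicBreakdownWitness_const_force (hns : IsNavierStokesSolution ν 0 u₀ u p)
    (hu : IsSmoothOnHalfSpace u) (hp : IsSmoothOnHalfSpace p)
    (hper : ∀ t, 0 ≤ t → IsLatticePeriodic (u t)) {a : ℝ → EuclideanSpace ℝ ι}
    (ha : ContDiff ℝ ∞ a) :
    ¬ ¬ ∃ (v : ℝ → EuclideanSpace ℝ ι → EuclideanSpace ℝ ι) (q : ℝ → EuclideanSpace ℝ ι → ℝ),
      IsSmoothOnHalfSpace v ∧ IsSmoothOnHalfSpace q ∧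
        IsNavierStokesSolution ν (fun t _ => a t) u₀ v q ∧ ∀ t, 0 ≤ t → IsLatticePeriodic (v t) :=
  fun h => h (periodicSolvable_const_force hns hu hp hper ha)

end Periodic

end Literature.Analysis.FluidPDE

end
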